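import Summits.RiemannHypothesis.RiemannHypothesis.Theorems.Splittings.RobinFiniteRefl
import Summits.RiemannHypothesis.RiemannHypothesis.Theorems.Splittings.RobinFiniteLowHeightRanges

/-!
# RobinFiniteReflLow — the LOW-HEIGHT law (`10⁵ ≤ T`) with the halved off-line charge (SPLIT-robin-finite gen 14, part 2/4)

Cell rh-split, card `cards/SPLIT-robin-finite.md` §21.  HONEST LABEL: «SPLITTING SEARCH over kernel-typed RH-EQUIVALENCES; a splitting A ∧ B ⟹ RH is CONDITIONAL bookkeeping unless A and B
are both proved; nothing here bears on the truth of RH.»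

Gen 11's low-height law (`RobinFiniteLowHeightInputs/Law`) re-run with the reflection-paired charge of part 1:
`tailH(T)·√P ↦ tailH(T)·(√P + 1/√P)/2` in the pointwise budget, the level conditions and the ramp conditions; Büthe's
range condition now follows from `tailH·2^{k+1} ≤ 1` (`le_of_tail_budget_refl`, `buthe_range_low_refl`: `√X ≤ πT/10`).
Same certified covers `cover11B_ok … cover17B_ok`, same `b_k`, same ramp constants; RH(T) in hypothesis position only.
-/

set_option linter.dupNamespace false

noncomputable section

open Real Filter Finset
open scoped Chebyshev ComplexConjugate

namespace Summit.RiemannHypothesis.RiemannHypothesis.Theorems.Splittings.RobinFiniteC1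

open Literature.NumberTheory.LFunctions Literature.NumberTheory.DiophantineGeometry
open Literature.NumberTheory.LFunctions.SchoenfeldBound
open Literature.NumberTheory.LFunctions.NicolasJExplicit
open RobinAnalyticSharp RobinAnalyticSharp.Cells
open Summit.RiemannHypothesis.RiemannHypothesis.Theorems.Splittings.RobinFiniteE3
open Summit.RiemannHypothesis.RiemannHypothesis.Theorems.Splittings.RobinFiniteTail
  (zeroTailBound_tailH tailH_PT_le tailH_nonneg tailH_1e5_le)
open Summit.RiemannHypothesis.RiemannHypothesis.Theorems.Splittings.RobinFiniteE1c (summable_tailTerm)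

section ReflLow

/-! ### R1 · the LOW-HEIGHT law (`10⁵ ≤ T`, tail-only price) re-run with the halved charge
(tree `RobinFiniteLowHeightInputs/Law/Ranges`, gen 11: `tailH(T)·√P` ↦ `tailH(T)·(√P + 1/√P)/2`) -/

/-- `a + a⁻¹ ≤ b + b⁻¹` for `1 ≤ a ≤ b` (`u ↦ u + 1/u` is increasing on `[1, ∞)`). -/
private theorem add_inv_le_add_inv {a b : ℝ} (ha : 1 ≤ a) (hab : a ≤ b) : a + a⁻¹ ≤ b + b⁻¹ := by
  have ha0 : 0 < a := by linarith
  have hb0 : 0 < b := by linarith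
  rw [← sub_nonneg]
  have e : b + b⁻¹ - (a + a⁻¹) = (b - a) * (1 - 1 / (a * b)) := by
    field_simp
    ring
  rw [e]
  refine mul_nonneg (by linarith) ?_
  rw [sub_nonneg, div_le_one (mul_pos ha0 hb0)]
  nlinarith

/-- **R1a · c = 1 · E1c⁻ ∧ (tail bound) ⟹ windowed E1, HALVED**: a tail bound `Σ_{|γ|>T} m/γ² ≤ h` gives Nicolas's lower
bound with budget `0.0463 + (1 + 2/log X₀)·h·(√X₁ + 1/√X₁)/2` on `[X₀, X₁]` (tree, unpaired: `·h·√X₁`,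
`partialNicolasBetween1_of_tail`; `u ↦ u + 1/u` is increasing on `[1, ∞)`). -/
theorem partialNicolasBetween1_refl_of_tail (hB : Buthe2018_thm2_theta) (hK : BroadbentEtAl2021_theta_rel_1e19)
    {T B h X₀ X₁ : ℝ}
    (ht : ∑' ρ : RHWave0.riemannZetaNontrivialZeros,
        (if T < |(ρ : ℂ).im| then (riemannZetaZeroOrder (ρ : ℂ) : ℝ) / (ρ : ℂ).im ^ 2 else 0) ≤ h)
    (hh : 0 ≤ h) (hX₀ : 1 < X₀) (hBB : X₁ ≤ B) :
    RiemannHypothesisUpTo T → (∀ y : ℝ, 599 ≤ y → y ≤ B → |θ y - y| ≤ √y * Real.log y ^ 2 / (8 * π)) →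
      ∀ x : ℝ, 599 ≤ x → X₀ ≤ x → x ≤ X₁ →
        -Real.log (nicolasF x) ≤ RobinAnalyticSharp.nicolasERH x +
            (0.0463 + (1 + 2 / Real.log X₀) * (h * ((√X₁ + (√X₁)⁻¹) / 2)) - nicolasBeta) *
              (1 / (√x * Real.log x) + 1 / (√x * Real.log x ^ 2) + 4 / (√x * Real.log x ^ 3)) := by
  refine partialNicolasBetween1_holds hB hK (fun x hx0 hx1 => ?_) (by positivity) hX₀ hBB
  have hx1' : 1 ≤ x := by linarith
  refine le_trans (offLineSumAt_refl_of_zeroTailBound ht hx1') (mul_le_mul_of_nonneg_left ?_ hh)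
  have hs1 : 1 ≤ √x := by rw [← Real.sqrt_one]; exact Real.sqrt_le_sqrt hx1'
  have := add_inv_le_add_inv hs1 (Real.sqrt_le_sqrt hx1)
  linarith

/-- **R1b · the same with the KERNEL's tail price `tailH(T)`** (∘ tree `RobinFiniteTail.zeroTailBound_tailH`), any `T ≥ 7`:
budget `0.0463 + (1 + 2/log X₀)·tailH(T)·(√X₁ + 1/√X₁)/2` (tree: `partialNicolasBetween1_tailFree` with `·tailH(T)·√X₁`). -/
theorem partialNicolasBetween1_refl_tailFree (hB : Buthe2018_thm2_theta) (hK : BroadbentEtAl2021_theta_rel_1e19)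
    {T B X₀ X₁ : ℝ} (hT : 7 ≤ T) (hX₀ : 1 < X₀) (hBB : X₁ ≤ B) :
    RiemannHypothesisUpTo T → (∀ y : ℝ, 599 ≤ y → y ≤ B → |θ y - y| ≤ √y * Real.log y ^ 2 / (8 * π)) →
      ∀ x : ℝ, 599 ≤ x → X₀ ≤ x → x ≤ X₁ →
        -Real.log (nicolasF x) ≤ RobinAnalyticSharp.nicolasERH x +
            (0.0463 + (1 + 2 / Real.log X₀) *
              (((Real.log (T / (2 * π)) + 1) / (π * T) + (184 + 30 * Real.log T) / T ^ 2) * ((√X₁ + (√X₁)⁻¹) / 2)) - nicolasBeta) *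
              (1 / (√x * Real.log x) + 1 / (√x * Real.log x ^ 2) + 4 / (√x * Real.log x ^ 3)) :=
  partialNicolasBetween1_refl_of_tail hB hK (zeroTailBound_tailH hT) (tailH_nonneg hT) hX₀ hBB

/-- **R1c · the pointwise lower bound at height `T`, HALVED** (tree `negLog_le_Eb_point`: `·tailH(T)·√P`):
`−log f(P) ≤ Eb(0.0463 + (1 + 2/log P)·tailH(T)·(√P + 1/√P)/2)(P)`. -/
theorem negLog_le_Eb_point_refl (hB : Buthe2018_thm2_theta) (hK : BroadbentEtAl2021_theta_rel_1e19)
    {T B P : ℝ} (hT : 7 ≤ T) (hRH : RiemannHypothesisUpTo T)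
    (hW : ∀ y : ℝ, 599 ≤ y → y ≤ B → |θ y - y| ≤ √y * Real.log y ^ 2 / (8 * π))
    (hP : 599 ≤ P) (hPB : P ≤ B) :
    -Real.log (nicolasF P) ≤ RobinAnalyticSharp.nicolasERH P +
        (0.0463 + (1 + 2 / Real.log P) *
          (((Real.log (T / (2 * π)) + 1) / (π * T) + (184 + 30 * Real.log T) / T ^ 2) * ((√P + (√P)⁻¹) / 2)) - nicolasBeta) *
          (1 / (√P * Real.log P) + 1 / (√P * Real.log P ^ 2) + 4 / (√P * Real.log P ^ 3)) :=
  partialNicolasBetween1_refl_tailFree hB hK (X₀ := P) (X₁ := P) hT (by linarith) hPB hRH hW P hP le_rfl le_rfl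

/-- `log(T/2π) ≥ 9` for `T ≥ 10⁵` (`2π·e⁹ ≤ 51 000`). -/
theorem nine_le_log_div_two_pi {T : ℝ} (hT : 100000 ≤ T) : 9 ≤ Real.log (T / (2 * π)) := by
  have hπu := Real.pi_lt_d6
  have hT0 : 0 < T := by linarith
  rw [Real.le_log_iff_exp_le (div_pos hT0 (by positivity)), le_div_iff₀ (by positivity)]
  have he := Real.exp_one_lt_d9
  have h9 : Real.exp 9 ≤ 2.7182818286 ^ 9 := by
    have e : Real.exp 9 = Real.exp 1 ^ 9 := by rw [← Real.exp_nat_mul]; norm_num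
    rw [e]; exact pow_le_pow_left₀ (Real.exp_pos 1).le he.le 9
  have h1 : Real.exp 9 * (2 * π) ≤ 2.7182818286 ^ 9 * 6.283186 :=
    mul_le_mul h9 (by linarith) (by positivity) (by positivity)
  have h2 : (2.7182818286 : ℝ) ^ 9 * 6.283186 ≤ 51000 := by norm_num
  linarith

/-- **R1d · from the halved budget to Büthe's range, step 1**: `tailH(T)·u ≤ 1`, `T ≥ 10⁵`, `u ≥ 0` ⟹ `u ≤ πT/10`
(`tailH(T) ≥ (log(T/2π) + 1)/(πT) ≥ 10/(πT)`; tree `le_of_tail_budget`: `tailH·u ≤ 1/2 ⟹ u ≤ πT/4`). -/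
theorem le_of_tail_budget_refl {T u : ℝ} (hT : 100000 ≤ T) (hu : 0 ≤ u)
    (h : ((Real.log (T / (2 * π)) + 1) / (π * T) + (184 + 30 * Real.log T) / T ^ 2) * u ≤ 1) :
    u ≤ π * T / 10 := by
  have hT0 : 0 < T := by linarith
  have hπT : 0 < π * T := mul_pos Real.pi_pos hT0
  have hlog := nine_le_log_div_two_pi hT
  have hlogT : 0 ≤ Real.log T := Real.log_nonneg (by linarith)
  have htail : 10 / (π * T) ≤ ((Real.log (T / (2 * π)) + 1) / (π * T) + (184 + 30 * Real.log T) / T ^ 2) := by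
    have h1 : 10 / (π * T) ≤ (Real.log (T / (2 * π)) + 1) / (π * T) :=
      div_le_div_of_nonneg_right (by linarith) hπT.le
    have h2 : 0 ≤ (184 + 30 * Real.log T) / T ^ 2 := div_nonneg (by linarith) (sq_nonneg T)
    linarith
  have h2 : 10 / (π * T) * u ≤ 1 := le_trans (mul_le_mul_of_nonneg_right htail hu) h
  rw [div_mul_eq_mul_div, div_le_iff₀ hπT] at h2
  linarith

/-- **R1d · step 2: Büthe's range condition from the (now doubled) window size**: `4¹¹ ≤ X`, `√X ≤ πT/10` give
`4.92·√(X/log X) ≤ T` (`X ≤ π²T²/100 ≤ 0.0987·T²`, `log X ≥ 15.249`; tree `buthe_range_low`: `√X ≤ πT/4`). -/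
theorem buthe_range_low_refl {T X : ℝ} (hT : 0 < T) (hX : (4 : ℝ) ^ 11 ≤ X) (h : √X ≤ π * T / 10) :
    4.92 * Real.sqrt (X / Real.log X) ≤ T := by
  have hπu := Real.pi_lt_d6
  have hX0 : 0 < X := lt_of_lt_of_le (by norm_num) hX
  have hsX : 0 ≤ √X := Real.sqrt_nonneg X
  have hXT : X ≤ 0.0987 * T ^ 2 := by
    have h1 : √X * √X ≤ (π * T / 10) * (π * T / 10) := mul_le_mul h h hsX (by positivity)
    rw [Real.mul_self_sqrt hX0.le] at h1
    nlinarith [mul_pos hT hT, mul_nonneg (sub_nonneg.2 hπu.le) Real.pi_pos.le]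
  have hlogX : (15.249 : ℝ) ≤ Real.log X := by
    obtain ⟨-, hL, -⟩ := range_facts (k := 11) (by norm_num)
    have hL' : (15.249 : ℝ) ≤ ((L1 11 : ℚ) : ℝ) := by simp only [L1, l2]; push_cast; norm_num
    exact hL'.trans (hL.trans (Real.log_le_log (by norm_num) hX))
  have hq : X / Real.log X ≤ (T / 4.92) ^ 2 := by
    have e : (T / 4.92) ^ 2 = T ^ 2 / 24.2064 := by ring
    rw [e, div_le_div_iff₀ (by linarith) (by norm_num)]
    nlinarith [mul_nonneg (sq_nonneg T) (sub_nonneg.2 hlogX)]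
  calc 4.92 * Real.sqrt (X / Real.log X) ≤ 4.92 * Real.sqrt ((T / 4.92) ^ 2) :=
        mul_le_mul_of_nonneg_left (Real.sqrt_le_sqrt hq) (by norm_num)
    _ = T := by rw [Real.sqrt_sq (by positivity)]; ring

/-- **R1e · the CA Mertens inequality on the level `4ᵏ ≤ P ≤ 4ᵏ⁺¹` (`11 ≤ k ≤ 17`) at ANY `T ≥ 10⁵` under the HALVED LEVEL
CONDITION `0.0463 + (1 + 2/L1 k)·tailH(T)·(2^{k+1} + 2^{−(k+1)})/2 ≤ b_k`** (tree `mertensProdLt_level`: `·tailH(T)·2^{k+1}`;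
same certified covers `cover11B_ok … cover17B_ok`, same `b_k`; the level condition still forces Büthe's range: `tailH·2^{k+1} ≤ 1`). -/
theorem mertensProdLt_level_refl (h16 : Buthe2016_thm2) (hB : Buthe2018_thm2_theta)
    (hK : BroadbentEtAl2021_theta_rel_1e19) {T : ℝ} (hT : 100000 ≤ T) (hRH : RiemannHypothesisUpTo T)
    {k : ℕ} (hk11 : 11 ≤ k) (hk17 : k ≤ 17)
    (hlev : 0.0463 + (1 + 2 / ((L1 k : ℚ) : ℝ)) *
      (((Real.log (T / (2 * π)) + 1) / (π * T) + (184 + 30 * Real.log T) / T ^ 2) * (((2 : ℝ) ^ (k + 1) + ((2 : ℝ) ^ (k + 1))⁻¹) / 2)) ≤ ((bk k : ℚ) : ℝ))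
    {P Q : ℕ} (hPl : 4 ^ k ≤ P) (hPu : P ≤ 4 ^ (k + 1)) (hQP : Q ≤ P) :
    (∏ p ∈ Nat.primesLE P, (1 - (p : ℝ)⁻¹))⁻¹ *
        ∏ p ∈ (Nat.primesLE P).filter (fun p => Q < p), (1 - ((p : ℝ) ^ 2)⁻¹) <
      rexp eulerMascheroniConstant * Real.log (θ P + θ Q) := by
  have hT0 : 0 < T := by linarith
  have hT7 : (7 : ℝ) ≤ T := by linarith
  have ht0 := tailH_nonneg hT7
  obtain ⟨hP₁599, hL₁, -, -, hL₁8, -, -⟩ := range_facts (k := k) (by omega)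
  have hPr : (4 : ℝ) ^ k ≤ P := by exact_mod_cast hPl
  have hPur : (P : ℝ) ≤ (4 : ℝ) ^ (k + 1) := by exact_mod_cast hPu
  have hP599 : (599 : ℝ) ≤ P := hP₁599.trans hPr
  have hP11 : 4 ^ 11 ≤ P := le_trans (Nat.pow_le_pow_right (by norm_num) hk11) hPl
  have hbk : ((bk k : ℚ) : ℝ) ≤ 1 / 2 := by interval_cases k <;> norm_num [bk]
  have hL₁0 : (0 : ℝ) < ((L1 k : ℚ) : ℝ) := by linarith
  have hfac0 : (0 : ℝ) ≤ 2 / ((L1 k : ℚ) : ℝ) := by positivity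
  have h2k : √((4 : ℝ) ^ (k + 1)) = 2 ^ (k + 1) := sqrt_four_pow (k + 1)
  set t : ℝ := ((Real.log (T / (2 * π)) + 1) / (π * T) + (184 + 30 * Real.log T) / T ^ 2) with ht_def
  set u : ℝ := (2 : ℝ) ^ (k + 1) with hu_def
  have hu1 : (1 : ℝ) ≤ u := one_le_pow₀ (by norm_num)
  have hu0 : 0 < u := by positivity
  have hinv : 0 ≤ u⁻¹ := by positivity
  -- Büthe's range for `B = 4ᵏ⁺¹`: the halved level condition still forces `t·u ≤ 1`
  have htu : t * u ≤ 1 := by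
    have h1 : t * u / 2 ≤ t * ((u + u⁻¹) / 2) := by nlinarith [mul_nonneg ht0 hinv]
    have h2 : t * ((u + u⁻¹) / 2) ≤ (1 + 2 / ((L1 k : ℚ) : ℝ)) * (t * ((u + u⁻¹) / 2)) :=
      le_mul_of_one_le_left (mul_nonneg ht0 (by positivity)) (by linarith)
    linarith
  have hrange : 4.92 * Real.sqrt ((4 : ℝ) ^ (k + 1) / Real.log ((4 : ℝ) ^ (k + 1))) ≤ T := by
    refine buthe_range_low_refl hT0 (pow_le_pow_right₀ (by norm_num) (by omega)) ?_
    rw [h2k]; exact le_of_tail_budget_refl hT hu0.le htu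
  have hW := thetaWindow_low h16 hT0 hRH hrange
  have hlow := negLog_le_Eb_point_refl hB hK hT7 hRH hW hP599 hPur
  -- the pointwise budget is `≤ b_k`
  have hlogP : ((L1 k : ℚ) : ℝ) ≤ Real.log P := hL₁.trans (Real.log_le_log (by positivity) hPr)
  have h2 : 2 / Real.log (P : ℝ) ≤ 2 / ((L1 k : ℚ) : ℝ) := div_le_div_of_nonneg_left (by norm_num) hL₁0 hlogP
  have h2' : (0 : ℝ) ≤ 2 / Real.log (P : ℝ) := div_nonneg (by norm_num) (hL₁0.le.trans hlogP)
  have hsP1 : 1 ≤ √(P : ℝ) := by rw [← Real.sqrt_one]; exact Real.sqrt_le_sqrt (by linarith)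
  have hsP : √(P : ℝ) ≤ u := by rw [← h2k]; exact Real.sqrt_le_sqrt hPur
  have hch : (√(P : ℝ) + (√(P : ℝ))⁻¹) / 2 ≤ (u + u⁻¹) / 2 := by
    have := add_inv_le_add_inv hsP1 hsP; linarith
  have hch0 : 0 ≤ (√(P : ℝ) + (√(P : ℝ))⁻¹) / 2 := by positivity
  have h3 : t * ((√(P : ℝ) + (√(P : ℝ))⁻¹) / 2) ≤ t * ((u + u⁻¹) / 2) := mul_le_mul_of_nonneg_left hch ht0
  have h4 : (1 + 2 / Real.log (P : ℝ)) * (t * ((√(P : ℝ) + (√(P : ℝ))⁻¹) / 2)) ≤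
      (1 + 2 / ((L1 k : ℚ) : ℝ)) * (t * ((u + u⁻¹) / 2)) :=
    mul_le_mul (by linarith) h3 (mul_nonneg ht0 hch0) (by linarith)
  have hbud : 0.0463 + (1 + 2 / Real.log (P : ℝ)) * (t * ((√(P : ℝ) + (√(P : ℝ))⁻¹) / 2)) ≤ ((bk k : ℚ) : ℝ) := by
    linarith
  have hkey := key_ineq_levelB hW hk11 hk17 hPl hPu hPur hQP hbud
  exact mertens_prod_lt_of hW hP11 hPur hlow hkey

/-- **R1f · a ramp window at height `T`, HALVED**: if `(1 + 2/log P)·tailH(T)·(√P + 1/√P)/2 ≤ u ≤ 1/2`,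
`Eb(0.0463 + u)(P)·√P log P < c` and `c/(√P log P) ≤ G₁ + G₂` on the `θ`-window `[599, P]`, then the CA Mertens inequality holds
at `(P, Q)` (tree `mertens_of_ramp`: `·tailH(T)·√P`; Büthe's range from `tailH·√P ≤ 1`). -/
theorem mertens_of_ramp_refl (h16 : Buthe2016_thm2) (hB : Buthe2018_thm2_theta) (hK : BroadbentEtAl2021_theta_rel_1e19)
    {T : ℝ} (hT : 100000 ≤ T) (hRH : RiemannHypothesisUpTo T) {P Q : ℕ} (hP : 4 ^ 11 ≤ P) {u c : ℝ}
    (hu : (1 + 2 / Real.log (P : ℝ)) *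
      (((Real.log (T / (2 * π)) + 1) / (π * T) + (184 + 30 * Real.log T) / T ^ 2) * ((√(P : ℝ) + (√(P : ℝ))⁻¹) / 2)) ≤ u) (hu2 : u ≤ 1 / 2)
    (hlt : (nicolasERH P + ((0.0463 + u) - nicolasBeta) * (1 / (√P * Real.log P) + 1 / (√P * Real.log P ^ 2) + 4 / (√P * Real.log P ^ 3))) *
      (√P * Real.log P) < c)
    (hG : (∀ y : ℝ, 599 ≤ y → y ≤ (P : ℝ) → |θ y - y| ≤ √y * Real.log y ^ 2 / (8 * π)) →
      c / (√(P : ℝ) * Real.log P) ≤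
        ∑ p ∈ (Nat.primesLE P).filter (fun p => Q < p), ((p : ℝ) ^ 2)⁻¹ + θ Q / ((θ P + θ Q) * Real.log (θ P + θ Q))) :
    (∏ p ∈ Nat.primesLE P, (1 - (p : ℝ)⁻¹))⁻¹ *
        ∏ p ∈ (Nat.primesLE P).filter (fun p => Q < p), (1 - ((p : ℝ) ^ 2)⁻¹) <
      rexp eulerMascheroniConstant * Real.log (θ P + θ Q) := by
  have hT0 : 0 < T := by linarith
  have hT7 : (7 : ℝ) ≤ T := by linarith
  have ht0 := tailH_nonneg hT7
  have hPr : (4 : ℝ) ^ 11 ≤ P := by exact_mod_cast hP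
  have hP599 : (599 : ℝ) ≤ P := le_trans (by norm_num) hPr
  have hP1 : (1 : ℝ) < P := by linarith
  have hlogP0 : 0 < Real.log (P : ℝ) := Real.log_pos hP1
  have hsL : 0 < √(P : ℝ) * Real.log P := mul_pos (Real.sqrt_pos.2 (by linarith)) hlogP0
  have h1 : (1 : ℝ) ≤ 1 + 2 / Real.log (P : ℝ) := le_add_of_nonneg_right (by positivity)
  set t : ℝ := ((Real.log (T / (2 * π)) + 1) / (π * T) + (184 + 30 * Real.log T) / T ^ 2) with ht_def
  have hs0 : 0 ≤ √(P : ℝ) := Real.sqrt_nonneg _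
  have hinv : 0 ≤ (√(P : ℝ))⁻¹ := by positivity
  have htP : t * √(P : ℝ) ≤ 1 := by
    have h1' : t * √(P : ℝ) / 2 ≤ t * ((√(P : ℝ) + (√(P : ℝ))⁻¹) / 2) := by nlinarith [mul_nonneg ht0 hinv]
    have h2' : t * ((√(P : ℝ) + (√(P : ℝ))⁻¹) / 2) ≤
        (1 + 2 / Real.log (P : ℝ)) * (t * ((√(P : ℝ) + (√(P : ℝ))⁻¹) / 2)) :=
      le_mul_of_one_le_left (mul_nonneg ht0 (by positivity)) h1
    linarith
  have hrange := buthe_range_low_refl hT0 hPr (le_of_tail_budget_refl hT hs0 htP)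
  have hW := thetaWindow_low h16 hT0 hRH hrange
  have hlow := negLog_le_Eb_point_refl hB hK hT7 hRH hW hP599 le_rfl
  have hmono := Eb_mono hP1 (show 0.0463 + (1 + 2 / Real.log (P : ℝ)) *
      (t * ((√(P : ℝ) + (√(P : ℝ))⁻¹) / 2)) ≤ 0.0463 + u by linarith)
  exact mertens_prod_lt_of hW hP le_rfl hlow (hmono.trans_lt (((lt_div_iff₀ hsL).2 hlt).trans_le (hG hW)))

/-- **R1g · THE LOW-HEIGHT CA MERTENS LAW, HALVED** (tree `mertensProdLt_low`): at ANY `T ≥ 10⁵`, the CA Mertens inequality for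
`4¹¹ ≤ P ≤ X`, `Q ≤ P`, provided every level `4ᵏ ≤ X` passes its HALVED level condition and the ramp window(s) `X` reaches satisfy
`(1 + 2/log X₀)·tailH(T)·(√m + 1/√m)/2 ≤ κ`, `m = min X X₁` — same dispatch, same ramp constants `κ₁a = 0.0773`, `κ₁b = 0.0904`,
`κ₂ = 0.4526`, same landed `Eb_ramp1a/1b/2_lt`, `G_largeW`, `G_large2W`. -/
theorem mertensProdLt_low_refl (h16 : Buthe2016_thm2) (hB : Buthe2018_thm2_theta)
    (hK : BroadbentEtAl2021_theta_rel_1e19) {T : ℝ} (hT : 100000 ≤ T) (hRH : RiemannHypothesisUpTo T) {X : ℝ}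
    (hcell : ∀ k : ℕ, 11 ≤ k → k ≤ 17 → (4 : ℝ) ^ k ≤ X → 0.0463 + (1 + 2 / ((L1 k : ℚ) : ℝ)) *
      (((Real.log (T / (2 * π)) + 1) / (π * T) + (184 + 30 * Real.log T) / T ^ 2) * (((2 : ℝ) ^ (k + 1) + ((2 : ℝ) ^ (k + 1))⁻¹) / 2)) ≤ ((bk k : ℚ) : ℝ))
    (hr1a : (4 : ℝ) ^ 18 ≤ X → (1 + 2 / Real.log ((4 : ℝ) ^ 18)) *
      (((Real.log (T / (2 * π)) + 1) / (π * T) + (184 + 30 * Real.log T) / T ^ 2) * ((√(min X ((10 : ℝ) ^ 14)) + (√(min X ((10 : ℝ) ^ 14)))⁻¹) / 2)) ≤ 0.0773)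
    (hr1b : (10 : ℝ) ^ 14 < X → (1 + 2 / Real.log ((10 : ℝ) ^ 14)) *
      (((Real.log (T / (2 * π)) + 1) / (π * T) + (184 + 30 * Real.log T) / T ^ 2) * ((√(min X (2 * (10 : ℝ) ^ 19)) + (√(min X (2 * (10 : ℝ) ^ 19)))⁻¹) / 2)) ≤ 0.0904)
    (hr2 : 2 * (10 : ℝ) ^ 19 < X → (1 + 2 / Real.log (2 * (10 : ℝ) ^ 19)) *
      (((Real.log (T / (2 * π)) + 1) / (π * T) + (184 + 30 * Real.log T) / T ^ 2) * ((√X + (√X)⁻¹) / 2)) ≤ 0.4526)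
    {P Q : ℕ} (hP : 4 ^ 11 ≤ P) (hPX : (P : ℝ) ≤ X) (hQP : Q ≤ P) :
    (∏ p ∈ Nat.primesLE P, (1 - (p : ℝ)⁻¹))⁻¹ *
        ∏ p ∈ (Nat.primesLE P).filter (fun p => Q < p), (1 - ((p : ℝ) ^ 2)⁻¹) <
      rexp eulerMascheroniConstant * Real.log (θ P + θ Q) := by
  have hT7 : (7 : ℝ) ≤ T := by linarith
  have ht0 := tailH_nonneg hT7
  set t : ℝ := ((Real.log (T / (2 * π)) + 1) / (π * T) + (184 + 30 * Real.log T) / T ^ 2) with ht_def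
  have hPr : (4 : ℝ) ^ 11 ≤ P := by exact_mod_cast hP
  have hP0 : P ≠ 0 := by positivity
  by_cases h18 : P < 4 ^ 18
  · -- CELLS: the level `k = Nat.log 4 P ∈ [11, 17]`
    have hPl : 4 ^ Nat.log 4 P ≤ P := Nat.pow_log_le_self 4 hP0
    have hPu : P < 4 ^ (Nat.log 4 P + 1) := Nat.lt_pow_succ_log_self (by norm_num) P
    have hk11 : 11 ≤ Nat.log 4 P := by
      by_contra h; push Not at h
      have : 4 ^ (Nat.log 4 P + 1) ≤ 4 ^ 11 := Nat.pow_le_pow_right (by norm_num) (by omega)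
      omega
    have hk17 : Nat.log 4 P ≤ 17 := by
      by_contra h; push Not at h
      have : 4 ^ 18 ≤ 4 ^ Nat.log 4 P := Nat.pow_le_pow_right (by norm_num) (by omega)
      omega
    have hkX : (4 : ℝ) ^ Nat.log 4 P ≤ X := le_trans (by exact_mod_cast hPl) hPX
    exact mertensProdLt_level_refl h16 hB hK hT hRH hk11 hk17 (hcell _ hk11 hk17 hkX) hPl hPu.le hQP
  · rw [not_lt] at h18
    have h18r : (4 : ℝ) ^ 18 ≤ P := by exact_mod_cast h18
    have hX18 : (4 : ℝ) ^ 18 ≤ X := h18r.trans hPX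
    have hbig10 : (2 * 10 ^ 10 : ℝ) ≤ P := le_trans (by norm_num) h18r
    have hP1 : (1 : ℝ) < P := lt_of_lt_of_le (by norm_num) h18r
    have hlogP0 : 0 < Real.log (P : ℝ) := Real.log_pos hP1
    have hsP0 : 0 ≤ √(P : ℝ) := Real.sqrt_nonneg _
    have hsP1 : 1 ≤ √(P : ℝ) := by rw [← Real.sqrt_one]; exact Real.sqrt_le_sqrt hP1.le
    -- `2/log P ≤ 2/log X₀` and `(√P + 1/√P)/2 ≤ (√m + 1/√m)/2`, `m = min X X₁ ≥ P`
    have hexcess : ∀ {X₀ X₁ : ℝ}, 1 < X₀ → X₀ ≤ P → (P : ℝ) ≤ X₁ →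
        (1 + 2 / Real.log (P : ℝ)) * (t * ((√(P : ℝ) + (√(P : ℝ))⁻¹) / 2)) ≤
          (1 + 2 / Real.log X₀) * (t * ((√(min X X₁) + (√(min X X₁))⁻¹) / 2)) := by
      intro X₀ X₁ hX₀ hX₀P hPX₁
      have hl0 : 0 < Real.log X₀ := Real.log_pos hX₀
      have h2 : 2 / Real.log (P : ℝ) ≤ 2 / Real.log X₀ :=
        div_le_div_of_nonneg_left (by norm_num) hl0 (Real.log_le_log (by linarith) hX₀P)
      have h3 : √(P : ℝ) ≤ √(min X X₁) := Real.sqrt_le_sqrt (le_min hPX hPX₁)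
      have hch : (√(P : ℝ) + (√(P : ℝ))⁻¹) / 2 ≤ (√(min X X₁) + (√(min X X₁))⁻¹) / 2 := by
        have := add_inv_le_add_inv hsP1 h3; linarith
      have hch0 : 0 ≤ (√(P : ℝ) + (√(P : ℝ))⁻¹) / 2 := by positivity
      have h2' : (0 : ℝ) ≤ 2 / Real.log X₀ := by positivity
      exact mul_le_mul (by linarith) (mul_le_mul_of_nonneg_left hch ht0) (mul_nonneg ht0 hch0) (by linarith)
    rcases le_or_gt (P : ℝ) ((10 : ℝ) ^ 14) with h14 | h14
    · -- RAMP 1a `[4¹⁸, 10¹⁴]`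
      have hu := hr1a hX18
      exact mertens_of_ramp_refl h16 hB hK hT hRH hP (hexcess (by norm_num) h18r h14) (hu.trans (by norm_num))
        (Eb_ramp1a_lt h18r h14 hu) (fun hW => G_largeW hW hbig10 le_rfl hQP)
    rcases le_or_gt (P : ℝ) (2 * (10 : ℝ) ^ 19) with h19 | h19
    · -- RAMP 1b `(10¹⁴, 2·10¹⁹]`
      have hu := hr1b (h14.trans_le hPX)
      exact mertens_of_ramp_refl h16 hB hK hT hRH hP (hexcess (by norm_num) h14.le h19) (hu.trans (by norm_num))
        (Eb_ramp1b_lt h14.le h19 hu) (fun hW => G_largeW hW hbig10 le_rfl hQP)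
    · -- RAMP 2 `(2·10¹⁹, X]`
      have hu := hr2 (h19.trans_le hPX)
      have hexcess2 : (1 + 2 / Real.log (P : ℝ)) * (t * ((√(P : ℝ) + (√(P : ℝ))⁻¹) / 2)) ≤
          (1 + 2 / Real.log (2 * (10 : ℝ) ^ 19)) * (t * ((√X + (√X)⁻¹) / 2)) := by
        have h := hexcess (X₀ := 2 * (10 : ℝ) ^ 19) (X₁ := X) (by norm_num) h19.le hPX
        rwa [min_self] at h
      have hL₁P : (44.442 : ℝ) ≤ Real.log P := log_2e19_bounds.1.trans (Real.log_le_log (by norm_num) h19.le)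
      exact mertens_of_ramp_refl h16 hB hK hT hRH hP hexcess2 (hu.trans (by norm_num)) (Eb_ramp2_lt h19.le hu)
        (fun hW => G_large2W hW h19.le le_rfl hQP hL₁P (by norm_num) (c := 2.5422) (by norm_num) (by norm_num))

open scoped ArithmeticFunction.sigma in
/-- **R1h · THE LOW-HEIGHT CA-SIDE HEIGHT LAW, HALVED.  RH verified to ANY height `T ≥ 10⁵` + {Büthe 2016 Thm 2, Büthe 2018 Thm 2,
BKLNW 2021} ⟹ Robin's inequality at every colossally abundant `N > 5040` all of whose primes are `≤ X`**, for every natural `X`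
passing the HALVED cell conditions of the levels `≤ X` and the HALVED ramp conditions of the windows `X` reaches (tree
`robinCA_below_low`; primes `< 4¹¹` by the kernel theorem `robinCA_below_four_pow_eleven`).  The functional equation of `ζ` is the
only new ingredient; no conjecture in hypothesis position; nothing here bears on the truth of RH. -/
theorem robinCA_below_low_refl (h16 : Buthe2016_thm2) (hB : Buthe2018_thm2_theta)
    (hK : BroadbentEtAl2021_theta_rel_1e19) {T : ℝ} (hT : 100000 ≤ T) (hRH : RiemannHypothesisUpTo T) {X : ℕ}
    (hcell : ∀ k : ℕ, 11 ≤ k → k ≤ 17 → (4 : ℝ) ^ k ≤ (X : ℝ) → 0.0463 + (1 + 2 / ((L1 k : ℚ) : ℝ)) *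
      (((Real.log (T / (2 * π)) + 1) / (π * T) + (184 + 30 * Real.log T) / T ^ 2) * (((2 : ℝ) ^ (k + 1) + ((2 : ℝ) ^ (k + 1))⁻¹) / 2)) ≤ ((bk k : ℚ) : ℝ))
    (hr1a : (4 : ℝ) ^ 18 ≤ (X : ℝ) → (1 + 2 / Real.log ((4 : ℝ) ^ 18)) *
      (((Real.log (T / (2 * π)) + 1) / (π * T) + (184 + 30 * Real.log T) / T ^ 2) * ((√(min (X : ℝ) ((10 : ℝ) ^ 14)) + (√(min (X : ℝ) ((10 : ℝ) ^ 14)))⁻¹) / 2)) ≤ 0.0773)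
    (hr1b : (10 : ℝ) ^ 14 < (X : ℝ) → (1 + 2 / Real.log ((10 : ℝ) ^ 14)) *
      (((Real.log (T / (2 * π)) + 1) / (π * T) + (184 + 30 * Real.log T) / T ^ 2) * ((√(min (X : ℝ) (2 * (10 : ℝ) ^ 19)) + (√(min (X : ℝ) (2 * (10 : ℝ) ^ 19)))⁻¹) / 2)) ≤ 0.0904)
    (hr2 : 2 * (10 : ℝ) ^ 19 < (X : ℝ) → (1 + 2 / Real.log (2 * (10 : ℝ) ^ 19)) *
      (((Real.log (T / (2 * π)) + 1) / (π * T) + (184 + 30 * Real.log T) / T ^ 2) * ((√(X : ℝ) + (√(X : ℝ))⁻¹) / 2)) ≤ 0.4526) :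
    robinCA_below (X + 1) := by
  intro N hCA h5040 hprimes
  obtain ⟨ε, P, Q, -, -, hP, hPN, -, hQP, hpf, -, -, hσ, hθ, -⟩ := hCA.exists_structure
  by_cases hsmall : P < 4 ^ 11
  · refine robinCA_below_four_pow_eleven N hCA h5040 fun p hp hpN => lt_of_le_of_lt ?_ hsmall
    have hN0 : N ≠ 0 := by omega
    have : p ∈ N.primeFactors := Nat.mem_primeFactors.2 ⟨hp, hpN, hN0⟩
    rw [hpf] at this
    exact (Nat.mem_primesLE.1 this).1
  · rw [not_lt] at hsmall
    have hPX : (P : ℝ) ≤ X := by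
      have := hprimes P hP hPN
      exact_mod_cast Nat.lt_succ_iff.1 this
    have hlt := mertensProdLt_low_refl h16 hB hK hT hRH hcell hr1a hr1b hr2 hsmall hPX hQP
    have hN0 : N ≠ 0 := by omega
    have hNpos : (0 : ℝ) < N := by exact_mod_cast Nat.pos_of_ne_zero hN0
    have hθpos : 0 < θ P + θ Q := by
      have h1 : 0 < θ (P : ℝ) := Chebyshev.theta_pos (by exact_mod_cast hP.two_le)
      have h2 : 0 ≤ θ (Q : ℝ) := Chebyshev.theta_nonneg _
      linarith
    have hlog : Real.log (θ P + θ Q) ≤ Real.log (Real.log N) := Real.log_le_log hθpos hθ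
    have hlt' : (σ 1 N : ℝ) / N < rexp eulerMascheroniConstant * Real.log (Real.log N) :=
      lt_of_le_of_lt hσ (hlt.trans_le (mul_le_mul_of_nonneg_left hlog (Real.exp_pos _).le))
    unfold robinInequality
    rw [div_lt_iff₀ hNpos] at hlt'
    linarith

end ReflLow

end Summit.RiemannHypothesis.RiemannHypothesis.Theorems.Splittings.RobinFiniteC1

end
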